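import Summits.CriticalPhenomena.PercolationContinuityZ3.Theorems.Transplant.KNParaChainRun
import Summits.CriticalPhenomena.PercolationContinuityZ3.Theorems.Transplant.KNCells2ChainS
import HarnessLib

/-!
# N1 (the `{±1}` node), LEVEL 1: the PLANAR SCHEDULE WITH SLAB TARGETS `ChainPlanar.ScheduleN` — D″'s `ChainPlanar.Schedule` with its
# shape-generic fields VERBATIM (`ax lo hi region prism N R′`, `encl succ sub_prism nonempty`) and the ROUTE property generalised to
# Martineau–Tassion strides (along-SLAB `sLo k ≤ σ(y_a − v_a) ≤ sHi k`, transverse drift `d k`, ASYMMETRIC pieces `[0, Pp k]` / `[−Pm k, 0]`, link box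
# `La k × Lb k`); doubly-signed boxes `dBox`; and the fixed-stride run `ChainPara.RunPrm` AS such a schedule (`RunPrm.scheduleN`) — pure `Site 2`

builds on p205010 (kernel theorem, internal audit signed; external expert review pending) — nothing in this file uses p205010; nothing here is a
claim about the open node `SamePDropOfSkeletonNeg`.
Lane `prim-bschramm`, seat `prim-bschramm-p1` (gen 11; NEG-SCOPE v1.1 §5 / P5-R2; spec `HOME/prim-bschramm-p1/N1-RUN-RECORDS.md`, lane INBOX
2026-08-21 ≈12:05Z); helper file (`--supports stmt-CriticalPhenomena-4575 --as helper`).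

WHY A NEW SCHEDULE RECORD.  `Schedule.route` targets the SIGN-HALF `{0 ≤ τ(y_{a′} − v_{a′})}` of the LINE `y_a − v_a = σℓ(v)`.  Martineau–Tassion's
y′-strides land in a LAYER (β′-thickness `n + |h|`) split at the OFF-CENTRE top point `v` (pieces `σα ∈ [v, n]` / `[−n, v]`), so neither the line nor
the sign-half is available; x-strides (side halves at the midpoint) would fit.  `ScheduleN` keeps every field the window chain `SkelPhiWinChainS`
§1–§2 / `lt_real_of_chainS` and the residues' schedule wrappers read (`level/region/core/N/R′`), and changes only `route` — whose one consumer
(`WinChainData.roomS → Skelφ.routeDatumS`) is re-typed for the Step-I″ pieces in any case.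
* §1 `dLo/dHi/dBox a σ c aLo aHi bLo bHi` (`{aLo ≤ σ(y_a − c_a) ≤ aHi} ∩ {bLo ≤ σ(y_{a′} − c_{a′}) ≤ bHi}` as an order interval; ONE sign for both
  coordinates — the central inversion flips both), `mem_dBox_iff`, `dBox_enlarge`, `dBox_mono`, `dBox_nonempty`;
* §2 **`ScheduleN`**, `ScheduleN.core/level/InPiece`, `level_zero`, `level_mono`, `level_subset_region`, **`route_level`** (names as `Schedule`'s API;
  next core ⊆ region / nonempty cores / regions ⊆ prism are the fields `succ` / `nonempty` / `sub_prism`);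
* §3 **`ChainPara.RunPrm.scheduleN`** (the fixed-stride run along axis `a` with sign `σ` from origin `c` as a `ScheduleN`; `R′ := ea = eb`), rfl API
  `scheduleN_core/_region/_ax/_N/_R'/_sLo/_sHi/_d/_Pp/_Pm/_La/_Lb`, `scheduleN_core_zero`.
[cite: MartineauTassion2017, §4.1, §4.3 Lemma 4.2 (arXiv:1312.1946 pp. 12–14)] [cite: KozmaNitzan2024, §4 Lemma 11 (pp. 22–23), Lemma 12 (pp. 23–25)]
-/

noncomputable section

namespace Summit.CriticalPhenomena.PercolationContinuityZ3.Theorems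

namespace Transplant

namespace ChainPlanar

open Literature.Probability.Percolation Literature.Probability.LatticeModels
open Literature.Probability.Percolation.KozmaNitzan
open Literature.Probability.Percolation.KozmaNitzan.Cells (oth oth_ne eq_oth_of_ne)

/-! ## §1 Doubly-signed boxes -/

/-- Lower corner of the doubly-signed box. [folklore] -/
def dLo (a : Fin 2) (σ : ℤ) (c : Site 2) (aLo aHi bLo bHi : ℤ) : Site 2 :=
  fun j => if j = a then (if σ = 1 then c a + aLo else c a - aHi) else (if σ = 1 then c j + bLo else c j - bHi)

/-- Upper corner of the doubly-signed box. [folklore] -/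
def dHi (a : Fin 2) (σ : ℤ) (c : Site 2) (aLo aHi bLo bHi : ℤ) : Site 2 :=
  fun j => if j = a then (if σ = 1 then c a + aHi else c a - aLo) else (if σ = 1 then c j + bHi else c j - bLo)

/-- **The doubly-signed box** `{aLo ≤ σ(y_a − c_a) ≤ aHi} ∩ {bLo ≤ σ(y_{a′} − c_{a′}) ≤ bHi}` (axis `a`, ONE sign `σ = ±1` read on both coordinates,
asymmetric transverse interval) as the order interval `Icc (dLo …) (dHi …)`. [cite: KozmaNitzan2024, §4 p. 15 (boxes)] -/
def dBox (a : Fin 2) (σ : ℤ) (c : Site 2) (aLo aHi bLo bHi : ℤ) : Finset (Site 2) :=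
  Finset.Icc (dLo a σ c aLo aHi bLo bHi) (dHi a σ c aLo aHi bLo bHi)

/-- Membership in a doubly-signed box. [folklore] -/
theorem mem_dBox_iff {a : Fin 2} {σ : ℤ} (hσ : σ = 1 ∨ σ = -1) {c : Site 2} {aLo aHi bLo bHi : ℤ} {y : Site 2} :
    y ∈ dBox a σ c aLo aHi bLo bHi ↔
      (aLo ≤ σ * (y a - c a) ∧ σ * (y a - c a) ≤ aHi) ∧ (bLo ≤ σ * (y (oth a) - c (oth a)) ∧ σ * (y (oth a) - c (oth a)) ≤ bHi) := by
  rw [dBox, Finset.mem_Icc]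
  constructor
  · intro ⟨h1, h2⟩
    have ha1 := h1 a; have ha2 := h2 a; have hb1 := h1 (oth a); have hb2 := h2 (oth a)
    simp only [dLo, dHi, if_true, if_neg (oth_ne a)] at ha1 ha2 hb1 hb2
    rcases hσ with rfl | rfl
    · simp only [if_true] at ha1 ha2 hb1 hb2; constructor <;> constructor <;> linarith
    · simp only [show (-1 : ℤ) ≠ 1 by norm_num, if_false] at ha1 ha2 hb1 hb2; constructor <;> constructor <;> linarith
  · rintro ⟨⟨ha1, ha2⟩, hb1, hb2⟩
    constructor <;> intro j <;> by_cases hj : j = a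
    · subst hj; simp only [dLo, if_true]
      rcases hσ with rfl | rfl
      · simp only [if_true]; linarith
      · simp only [show (-1 : ℤ) ≠ 1 by norm_num, if_false]; linarith
    · rw [eq_oth_of_ne hj]; simp only [dLo, if_neg (oth_ne a)]
      rcases hσ with rfl | rfl
      · simp only [if_true]; linarith
      · simp only [show (-1 : ℤ) ≠ 1 by norm_num, if_false]; linarith
    · subst hj; simp only [dHi, if_true]
      rcases hσ with rfl | rfl
      · simp only [if_true]; linarith
      · simp only [show (-1 : ℤ) ≠ 1 by norm_num, if_false]; linarith
    · rw [eq_oth_of_ne hj]; simp only [dHi, if_neg (oth_ne a)]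
      rcases hσ with rfl | rfl
      · simp only [if_true]; linarith
      · simp only [show (-1 : ℤ) ≠ 1 by norm_num, if_false]; linarith

/-- **Enlarging a doubly-signed box** by `R` in every coordinate. [cite: KozmaNitzan2024, §4 p. 15 (B⟨R⟩)] -/
theorem dBox_enlarge {a : Fin 2} {σ : ℤ} (hσ : σ = 1 ∨ σ = -1) (c : Site 2) (aLo aHi bLo bHi : ℤ) (R : ℕ) :
    Finset.Icc (dLo a σ c aLo aHi bLo bHi - ((R : ℕ) : Site 2)) (dHi a σ c aLo aHi bLo bHi + ((R : ℕ) : Site 2)) =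
      dBox a σ c (aLo - R) (aHi + R) (bLo - R) (bHi + R) := by
  ext y
  rw [mem_dBox_iff hσ, Finset.mem_Icc]
  constructor
  · intro ⟨h1, h2⟩
    have ha1 := h1 a; have ha2 := h2 a; have hb1 := h1 (oth a); have hb2 := h2 (oth a)
    simp only [dLo, dHi, Pi.sub_apply, Pi.add_apply, Pi.natCast_apply, if_true, if_neg (oth_ne a)] at ha1 ha2 hb1 hb2
    rcases hσ with rfl | rfl
    · simp only [if_true] at ha1 ha2 hb1 hb2; constructor <;> constructor <;> linarith
    · simp only [show (-1 : ℤ) ≠ 1 by norm_num, if_false] at ha1 ha2 hb1 hb2; constructor <;> constructor <;> linarith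
  · rintro ⟨⟨ha1, ha2⟩, hb1, hb2⟩
    constructor <;> intro j <;> simp only [Pi.sub_apply, Pi.add_apply, Pi.natCast_apply] <;> by_cases hj : j = a
    · subst hj; simp only [dLo, if_true]
      rcases hσ with rfl | rfl
      · simp only [if_true]; linarith
      · simp only [show (-1 : ℤ) ≠ 1 by norm_num, if_false]; linarith
    · rw [eq_oth_of_ne hj]; simp only [dLo, if_neg (oth_ne a)]
      rcases hσ with rfl | rfl
      · simp only [if_true]; linarith
      · simp only [show (-1 : ℤ) ≠ 1 by norm_num, if_false]; linarith
    · subst hj; simp only [dHi, if_true]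
      rcases hσ with rfl | rfl
      · simp only [if_true]; linarith
      · simp only [show (-1 : ℤ) ≠ 1 by norm_num, if_false]; linarith
    · rw [eq_oth_of_ne hj]; simp only [dHi, if_neg (oth_ne a)]
      rcases hσ with rfl | rfl
      · simp only [if_true]; linarith
      · simp only [show (-1 : ℤ) ≠ 1 by norm_num, if_false]; linarith

/-- Doubly-signed boxes are monotone in the four bounds. [folklore] -/
theorem dBox_mono {a : Fin 2} {σ : ℤ} (hσ : σ = 1 ∨ σ = -1) (c : Site 2) {aLo aHi bLo bHi aLo' aHi' bLo' bHi' : ℤ}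
    (h1 : aLo' ≤ aLo) (h2 : aHi ≤ aHi') (h3 : bLo' ≤ bLo) (h4 : bHi ≤ bHi') :
    dBox a σ c aLo aHi bLo bHi ⊆ dBox a σ c aLo' aHi' bLo' bHi' := by
  intro y hy
  rw [mem_dBox_iff hσ] at hy ⊢
  obtain ⟨⟨h5, h6⟩, h7, h8⟩ := hy
  exact ⟨⟨by linarith, by linarith⟩, by linarith, by linarith⟩

/-- A doubly-signed box with `aLo ≤ aHi`, `bLo ≤ bHi` is nonempty (it contains the corner `c + σ·aLo·e_a + σ·bLo·e_{a′}`). [folklore] -/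
theorem dBox_nonempty {a : Fin 2} {σ : ℤ} (hσ : σ = 1 ∨ σ = -1) (c : Site 2) {aLo aHi bLo bHi : ℤ} (ha : aLo ≤ aHi) (hb : bLo ≤ bHi) :
    (dBox a σ c aLo aHi bLo bHi).Nonempty := by
  refine ⟨fun j => if j = a then c a + σ * aLo else c j + σ * bLo, ?_⟩
  rw [mem_dBox_iff hσ]
  have hσσ : σ * σ = 1 := by rcases hσ with h | h <;> simp [h]
  simp only [if_true, if_neg (oth_ne a)]
  refine ⟨⟨?_, ?_⟩, ?_, ?_⟩
  · have : σ * (c a + σ * aLo - c a) = aLo := by linear_combination aLo * hσσ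
    rw [this]
  · have : σ * (c a + σ * aLo - c a) = aLo := by linear_combination aLo * hσσ
    rw [this]; exact ha
  · have : σ * (c (oth a) + σ * bLo - c (oth a)) = bLo := by linear_combination bLo * hσσ
    rw [this]
  · have : σ * (c (oth a) + σ * bLo - c (oth a)) = bLo := by linear_combination bLo * hσσ
    rw [this]; exact hb

/-! ## §2 Schedules with slab targets -/

/-- **A planar schedule of `N + 1` steps with SLAB TARGETS** (Martineau–Tassion strides): step `k` has the core box `Icc (lo k) (hi k)`, the region
`region k ⊆ prism`, the axis `ax k`; the `R'`-enlarged core and the next core lie in the region, every core is nonempty; and (ROUTE) from every point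
`v` of the `R'`-enlarged core there is a sign `σ = ±1` such that the LINK BOX `{|y_a − v_a| ≤ La k, |y_{a′} − v_{a′}| ≤ Lb k}` (`a = ax k`) lies in
`region k` and, for a sign `τ`, every `y` of the along-SLAB `sLo k ≤ σ(y_a − v_a) ≤ sHi k` whose signed transverse offset `σ(y_{a′} − v_{a′}) − d k` lies in
the piece of sign `τ` (`[0, Pp k]` for `τ = 1`, `[−Pm k, 0]` for `τ = −1`) lies in the next core. [cite: MartineauTassion2017, §4.3 Lemma 4.2]
[cite: KozmaNitzan2024, §4 Lemma 11 (pp. 22–23), Lemma 12 (pp. 23–25)] -/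
structure ScheduleN where
  /-- the axis of step `k` -/
  ax : ℕ → Fin 2
  /-- lower corner of core `k` -/
  lo : ℕ → Site 2
  /-- upper corner of core `k` -/
  hi : ℕ → Site 2
  /-- the region of step `k` -/
  region : ℕ → Finset (Site 2)
  /-- one planar box holding every region -/
  prism : Finset (Site 2)
  /-- the steps are `0, …, N` -/
  N : ℕ
  /-- the planar neighbourhood radius (level depth `+ 1`, kit-centre displacement) -/
  R' : ℕ
  /-- minimal along-progress of the stride of step `k` -/
  sLo : ℕ → ℤ
  /-- maximal along-progress of the stride of step `k` -/
  sHi : ℕ → ℤ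
  /-- transverse drift of the stride of step `k` -/
  d : ℕ → ℤ
  /-- the `τ = 1` piece of step `k` is `[0, Pp k]` -/
  Pp : ℕ → ℕ
  /-- the `τ = −1` piece of step `k` is `[−Pm k, 0]` -/
  Pm : ℕ → ℕ
  /-- along half-size of the link box of step `k` -/
  La : ℕ → ℕ
  /-- transverse half-size of the link box of step `k` -/
  Lb : ℕ → ℕ
  /-- the `R'`-enlarged core lies in the region -/
  encl : ∀ k ≤ N, Finset.Icc (lo k - ((R' : ℕ) : Site 2)) (hi k + ((R' : ℕ) : Site 2)) ⊆ region k
  /-- the next core lies in the region -/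
  succ : ∀ k ≤ N, Finset.Icc (lo (k + 1)) (hi (k + 1)) ⊆ region k
  /-- every region lies in the prism -/
  sub_prism : ∀ k ≤ N, region k ⊆ prism
  /-- every core is nonempty -/
  nonempty : ∀ k ≤ N + 1, (Finset.Icc (lo k) (hi k)).Nonempty
  /-- the route property (slab targets) -/
  route : ∀ k ≤ N, ∀ v ∈ Finset.Icc (lo k - ((R' : ℕ) : Site 2)) (hi k + ((R' : ℕ) : Site 2)), ∃ σ : ℤ, (σ = 1 ∨ σ = -1) ∧
    (∀ y : Site 2, |y (ax k) - v (ax k)| ≤ La k → |y (oth (ax k)) - v (oth (ax k))| ≤ Lb k → y ∈ region k) ∧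
    ∃ τ : ℤ, (τ = 1 ∨ τ = -1) ∧ ∀ y : Site 2, sLo k ≤ σ * (y (ax k) - v (ax k)) → σ * (y (ax k) - v (ax k)) ≤ sHi k →
      ((τ = 1 → 0 ≤ σ * (y (oth (ax k)) - v (oth (ax k))) - d k ∧ σ * (y (oth (ax k)) - v (oth (ax k))) - d k ≤ Pp k) ∧
       (τ = -1 → -(Pm k : ℤ) ≤ σ * (y (oth (ax k)) - v (oth (ax k))) - d k ∧ σ * (y (oth (ax k)) - v (oth (ax k))) - d k ≤ 0)) →
      y ∈ Finset.Icc (lo (k + 1)) (hi (k + 1))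

namespace ScheduleN

variable (S : ScheduleN)

/-- Core `k` of the schedule. [folklore] -/
def core (k : ℕ) : Finset (Site 2) := Finset.Icc (S.lo k) (S.hi k)

/-- Level `j` of step `k`: the `j`-enlargement of core `k`. [cite: KozmaNitzan2024, §4 p. 15 (B⟨j⟩)] -/
def level (k j : ℕ) : Finset (Site 2) := Finset.Icc (S.lo k - ((j : ℕ) : Site 2)) (S.hi k + ((j : ℕ) : Site 2))

/-- The landing piece of sign `τ` at step `k`, as a predicate on the signed transverse offset `δ`. [cite: MartineauTassion2017, §3.2] -/
def InPiece (k : ℕ) (τ δ : ℤ) : Prop := (τ = 1 → 0 ≤ δ ∧ δ ≤ S.Pp k) ∧ (τ = -1 → -(S.Pm k : ℤ) ≤ δ ∧ δ ≤ 0)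

/-- Level `0` is the core (stated with the core unfolded; the `Schedule` twin states `= S.core k`). [folklore] -/
theorem level_zero (k : ℕ) : S.level k 0 = Finset.Icc (S.lo k) (S.hi k) := by
  simp [level]

/-- Levels grow (the smaller level unfolded). [folklore] -/
theorem level_mono (k : ℕ) {j j' : ℕ} (h : j ≤ j') :
    Finset.Icc (S.lo k - ((j : ℕ) : Site 2)) (S.hi k + ((j : ℕ) : Site 2)) ⊆ S.level k j' := by
  refine Finset.Icc_subset_Icc (fun i => ?_) (fun i => ?_) <;>
    simp only [Pi.sub_apply, Pi.add_apply, Pi.natCast_apply] <;> omega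

/-- Levels `j ≤ R'` of step `k ≤ N` lie in the region (the level unfolded; next core ⊆ region, nonempty cores and regions ⊆ prism are the fields
`succ`, `nonempty`, `sub_prism`). [cite: KozmaNitzan2024, §4 Lemma 10 (p. 17: B⟨R+1⟩ ⊆ D)] -/
theorem level_subset_region {k : ℕ} (hk : k ≤ S.N) {j : ℕ} (hj : j ≤ S.R') :
    Finset.Icc (S.lo k - ((j : ℕ) : Site 2)) (S.hi k + ((j : ℕ) : Site 2)) ⊆ S.region k :=
  (S.level_mono k hj).trans (S.encl k hk)

/-- **The route property from every point of a level `j ≤ R'`.** [cite: MartineauTassion2017, §4.3 Lemma 4.2] [cite: KozmaNitzan2024, §4 Lemma 11 (pp. 22–23)] -/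
theorem route_level {k : ℕ} (hk : k ≤ S.N) {j : ℕ} (hj : j ≤ S.R') {v : Site 2} (hv : v ∈ S.level k j) :
    ∃ σ : ℤ, (σ = 1 ∨ σ = -1) ∧
      (∀ y : Site 2, |y (S.ax k) - v (S.ax k)| ≤ S.La k → |y (oth (S.ax k)) - v (oth (S.ax k))| ≤ S.Lb k → y ∈ S.region k) ∧
      ∃ τ : ℤ, (τ = 1 ∨ τ = -1) ∧ ∀ y : Site 2, S.sLo k ≤ σ * (y (S.ax k) - v (S.ax k)) → σ * (y (S.ax k) - v (S.ax k)) ≤ S.sHi k →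
        S.InPiece k τ (σ * (y (oth (S.ax k)) - v (oth (S.ax k))) - S.d k) → y ∈ S.core (k + 1) :=
  S.route k hk v (S.level_mono k hj hv)

end ScheduleN

end ChainPlanar

/-! ## §3 The fixed-stride run as a schedule with slab targets -/

namespace ChainPara

open Literature.Probability.Percolation Literature.Probability.LatticeModels
open Literature.Probability.Percolation.KozmaNitzan.Cells (oth oth_ne eq_oth_of_ne)
open ChainPlanar

namespace RunPrm

/-- Core `k` of the run rendered on the plane: axis `a`, sign `σ`, origin `c`. [this work] -/
def pcore (P : RunPrm) (a : Fin 2) (σ : ℤ) (c : Site 2) (k : ℕ) : Finset (Site 2) := dBox a σ c (P.aLo k) (P.aHi k) (P.bLo k) (P.bHi k)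

/-- Region `k` of the run rendered on the plane. [this work] -/
def pregion (P : RunPrm) (a : Fin 2) (σ : ℤ) (c : Site 2) (k : ℕ) : Finset (Site 2) :=
  dBox a σ c (P.aLo k - P.ea - P.La) (P.aHi k + P.ea + P.La) (P.bLo k - P.eb - P.Lb) (P.bHi k + P.eb + P.Lb)

/-- The prism of the run rendered on the plane. [this work] -/
def pprism (P : RunPrm) (a : Fin 2) (σ : ℤ) (c : Site 2) : Finset (Site 2) :=
  dBox a σ c (-(P.q : ℤ) - ((P.N : ℤ) + 1) * P.ea - P.La) ((P.N : ℤ) * P.sHi + P.q + ((P.N : ℤ) + 1) * P.ea + P.La)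
    (-((P.N : ℤ) * |P.d|) - (P.Wm + ((P.N : ℤ) + 1) * P.eb) - P.Lb) ((P.N : ℤ) * |P.d| + (P.Wp + ((P.N : ℤ) + 1) * P.eb) + P.Lb)

variable {P : RunPrm} {a : Fin 2} {σ : ℤ} {c : Site 2}

/-- Planar membership in a core = run-coordinate membership. [folklore] -/
theorem mem_pcore_iff (hσ : σ = 1 ∨ σ = -1) {k : ℕ} {y : Site 2} :
    y ∈ P.pcore a σ c k ↔ P.InCore k (σ * (y a - c a)) (σ * (y (oth a) - c (oth a))) := by
  rw [pcore, mem_dBox_iff hσ]; simp only [InCore]; tauto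

/-- Planar membership in a region = run-coordinate membership. [folklore] -/
theorem mem_pregion_iff (hσ : σ = 1 ∨ σ = -1) {k : ℕ} {y : Site 2} :
    y ∈ P.pregion a σ c k ↔ P.InRegion k (σ * (y a - c a)) (σ * (y (oth a) - c (oth a))) := by
  rw [pregion, mem_dBox_iff hσ]; simp only [InRegion]; tauto

/-- Planar membership in the prism = run-coordinate membership. [folklore] -/
theorem mem_pprism_iff (hσ : σ = 1 ∨ σ = -1) {y : Site 2} :
    y ∈ P.pprism a σ c ↔ P.InPrism (σ * (y a - c a)) (σ * (y (oth a) - c (oth a))) := by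
  rw [pprism, mem_dBox_iff hσ]; simp only [InPrism]; tauto

/-- Planar membership in the `ea`-enlarged core = run-coordinate membership in the enlarged core (`eb = ea`). [folklore] -/
theorem mem_enlarge_iff (hσ : σ = 1 ∨ σ = -1) (heb : P.eb = P.ea) {k : ℕ} {y : Site 2} :
    y ∈ dBox a σ c (P.aLo k - P.ea) (P.aHi k + P.ea) (P.bLo k - P.ea) (P.bHi k + P.ea) ↔
      P.InEnl k (σ * (y a - c a)) (σ * (y (oth a) - c (oth a))) := by
  rw [mem_dBox_iff hσ]; simp only [InEnl, heb]; tauto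

/-- **THE FIXED-STRIDE RUN AS A SCHEDULE WITH SLAB TARGETS** (axis `a`, sign `σ`, origin `c`; `R' := ea = eb`).
[cite: MartineauTassion2017, §4.3 Lemma 4.2] [cite: KozmaNitzan2024, §4 Lemma 11 (pp. 22–23)] -/
def scheduleN (P : RunPrm) (a : Fin 2) {σ : ℤ} (hσ : σ = 1 ∨ σ = -1) (c : Site 2) (hP : RunOK P) (heb : P.eb = P.ea) : ScheduleN where
  ax := fun _ => a
  lo := fun k => dLo a σ c (P.aLo k) (P.aHi k) (P.bLo k) (P.bHi k)
  hi := fun k => dHi a σ c (P.aLo k) (P.aHi k) (P.bLo k) (P.bHi k)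
  region := fun k => P.pregion a σ c k
  prism := P.pprism a σ c
  N := P.N
  R' := P.ea
  sLo := fun _ => P.sLo
  sHi := fun _ => P.sHi
  d := fun _ => P.d
  Pp := fun _ => P.Pp
  Pm := fun _ => P.Pm
  La := fun _ => P.La
  Lb := fun _ => P.Lb
  encl k _ := by
    rw [dBox_enlarge hσ]
    intro y hy
    exact (mem_pregion_iff hσ).2 (inRegion_of_inEnl ((mem_enlarge_iff hσ heb).1 hy))
  succ k _ := by
    intro y hy
    exact (mem_pregion_iff hσ).2 (inRegion_of_inCore_succ hP ((mem_pcore_iff hσ).1 hy))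
  sub_prism k hk := by
    intro y hy
    exact (mem_pprism_iff hσ).2 (inPrism_of_inRegion hP hk ((mem_pregion_iff hσ).1 hy))
  nonempty k _ := by
    have h := inCore_nominal hP k
    exact dBox_nonempty hσ c (h.1.trans h.2.1) (h.2.2.1.trans h.2.2.2)
  route k _ v hv := by
    rw [dBox_enlarge hσ] at hv
    have hv' := (mem_enlarge_iff hσ heb).1 hv
    have hσσ : σ * σ = 1 := by rcases hσ with h | h <;> simp [h]
    refine ⟨σ, hσ, fun y hya hyb => (mem_pregion_iff hσ).2 (inRegion_of_link hv' ?_ ?_), P.steer k (σ * (v (oth a) - c (oth a))),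
      P.steer_eq_or k _, fun y h1 h2 hpc => (mem_pcore_iff hσ).2 (inCore_succ_of_landing hP hv' ?_ ?_ ?_)⟩
    · have : σ * (y a - c a) - σ * (v a - c a) = σ * (y a - v a) := by ring
      rw [this, abs_mul, show |σ| = 1 by rcases hσ with h | h <;> simp [h], one_mul]; exact hya
    · have : σ * (y (oth a) - c (oth a)) - σ * (v (oth a) - c (oth a)) = σ * (y (oth a) - v (oth a)) := by ring
      rw [this, abs_mul, show |σ| = 1 by rcases hσ with h | h <;> simp [h], one_mul]; exact hyb
    · have : σ * (y a - c a) - σ * (v a - c a) = σ * (y a - v a) := by ring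
      rw [this]; exact h1
    · have : σ * (y a - c a) - σ * (v a - c a) = σ * (y a - v a) := by ring
      rw [this]; exact h2
    · have : σ * (y (oth a) - c (oth a)) - σ * (v (oth a) - c (oth a)) - P.d = σ * (y (oth a) - v (oth a)) - P.d := by ring
      rw [this]; exact hpc

section API

variable (P : RunPrm) (a : Fin 2) {σ : ℤ} (hσ : σ = 1 ∨ σ = -1) (c : Site 2) (hP : RunOK P) (heb : P.eb = P.ea)

/-- The cores of the run schedule. [folklore] -/
@[simp] theorem scheduleN_core (k : ℕ) : (P.scheduleN a hσ c hP heb).core k = P.pcore a σ c k := rfl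

/-- The regions of the run schedule. [folklore] -/
@[simp] theorem scheduleN_region (k : ℕ) : (P.scheduleN a hσ c hP heb).region k = P.pregion a σ c k := rfl

/-- The prism of the run schedule. [folklore] -/
@[simp] theorem scheduleN_prism : (P.scheduleN a hσ c hP heb).prism = P.pprism a σ c := rfl

/-- The axis of the run schedule. [folklore] -/
@[simp] theorem scheduleN_ax (k : ℕ) : (P.scheduleN a hσ c hP heb).ax k = a := rfl

/-- The parameters of the run schedule. [folklore] -/
theorem scheduleN_params : (P.scheduleN a hσ c hP heb).N = P.N ∧ (P.scheduleN a hσ c hP heb).R' = P.ea ∧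
    (∀ k, (P.scheduleN a hσ c hP heb).sLo k = P.sLo ∧ (P.scheduleN a hσ c hP heb).sHi k = P.sHi ∧ (P.scheduleN a hσ c hP heb).d k = P.d ∧
      (P.scheduleN a hσ c hP heb).Pp k = P.Pp ∧ (P.scheduleN a hσ c hP heb).Pm k = P.Pm ∧ (P.scheduleN a hσ c hP heb).La k = P.La ∧
      (P.scheduleN a hσ c hP heb).Lb k = P.Lb) :=
  ⟨rfl, rfl, fun _ => ⟨rfl, rfl, rfl, rfl, rfl, rfl, rfl⟩⟩

/-- The start core is the start box `{|σ(y_a − c_a)| ≤ q, −Wm ≤ σ(y_{a′} − c_{a′}) ≤ Wp}`. [folklore] -/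
theorem mem_scheduleN_core_zero {y : Site 2} : y ∈ (P.scheduleN a hσ c hP heb).core 0 ↔
    (-(P.q : ℤ) ≤ σ * (y a - c a) ∧ σ * (y a - c a) ≤ P.q) ∧ (-(P.Wm : ℤ) ≤ σ * (y (oth a) - c (oth a)) ∧ σ * (y (oth a) - c (oth a)) ≤ P.Wp) := by
  rw [scheduleN_core, mem_pcore_iff hσ, inCore_zero_iff]; tauto

end API

end RunPrm

end ChainPara

end Transplant

end Summit.CriticalPhenomena.PercolationContinuityZ3.Theorems

end
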